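import Mathlib
import Literature.AlgebraicGeometry.Resolution.BlowupPointBranches
import Literature.AlgebraicGeometry.Resolution.BlowupDimension
import Literature.AlgebraicGeometry.Resolution.CurveDeltaDrop
import Literature.AlgebraicGeometry.Resolution.DefectlessDedekind
import HarnessLib

/-!
# `δ` drops under blowing up a singular point of a curve: `Σ_{x'} δ(x') < δ(x)`

Topic: `Literature/AlgebraicGeometry/Resolution`. The scheme-level form of the `δ`-drop theorem
(Kollár 2007, §1.4; the input "by embedded resolution of curves" of Cossart–Piltant 2008, proof of
Prop. 4.4, steps 1–2): let `ρ : C' → C` be a proper blowing up (`IsBlowup ρ J`) of integral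
locally Noetherian schemes, and `x ∈ C` a point at which `J_x = 𝔪_x`, `dim 𝒪_{C,x} = 1`, with
module-finite normalizations of `𝒪_{C,x}` and of the `𝒪_{C',x'}`, `ρ x' = x` (e.g. `C`, `C'`
excellent curves). Then the points `x'` over `x` are finite in number and, if `x` is a singular
point, **`Σ_{ρ x' = x} δ(𝒪_{C',x'}) < δ(𝒪_{C,x})`** (`IsBlowup.sum_curveDelta_fibre_lt`). Proof: the
images `S_{x'} = ε_{x'}(𝒪_{C',x'}) ⊆ K(C)` of the canonical embeddings
(`BlowupStalkEmbedding.lean`) form a first neighbourhood of `𝒪_{C,x}` in the sense of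
`CurveDeltaDrop.lean` (`IsBlowup.isFirstNeighbourhood_fibreSubalgebra`): they are one-dimensional
Noetherian local domains (`IsBlowup.ringKrullDim_stalk_le`), `𝔪_x ⊆ c_j S_{x'}` on the chart
through `x'` (`BlowupPointSubalgebra.lean`), and every branch of `𝒪_{C,x}` dominates exactly one
of them (`BlowupPointBranches.lean`, the valuative criteria); the finiteness of the fibre follows
(branches through distinct points are distinct), and `CurveDeltaDrop.sum_curveDelta_lt` applies.

## Sources

* J. Kollár, *Lectures on Resolution of Singularities* (2007), §1.4. [Kollar2007]
* V. Cossart, O. Piltant, J. Algebra 320 (2008), proof of Prop. 4.4, p. 10. [CossartPiltant2008]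
-/

noncomputable section

open CategoryTheory AlgebraicGeometry TopologicalSpace IsLocalRing IsDedekindDomain

namespace Literature.AlgebraicGeometry.Resolution

universe u

open Scheme.IdealSheafData

variable {C' C : Scheme.{u}} {ρ : C' ⟶ C} {J : C.IdealSheafData}
  [IsIntegral C] [IsIntegral C'] [IsLocallyNoetherian C]

/-! ## The local rings of the fibre inside `K(C)` -/

section Fibre

variable (hρ : IsBlowup ρ J) (x : C)

omit [IsIntegral C] [IsIntegral C'] [IsLocallyNoetherian C] in
/-- `ρ x' ⤳ x` and `x ⤳ ρ x'` for `ρ x' = x`. [folklore] -/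
theorem specializes_of_apply_eq {x' : C'} (hx' : ρ x' = x) : ρ x' ⤳ x ∧ x ⤳ ρ x' :=
  ⟨(Inseparable.of_eq hx').specializes, (Inseparable.of_eq hx').specializes'⟩

/-- **The local ring of a point of the fibre, inside `K(C)`**: the image `S_{x'}` of the
canonical embedding `ε_{x'} : 𝒪_{C',x'} → K(C)`, an `𝒪_{C,x}`-subalgebra. [cite: Kollar2007, §1.4] -/
def IsBlowup.fibreSubalgebra (x' : C') (hx' : ρ x' = x) :
    Subalgebra (C.presheaf.stalk x) C.functionField where
  carrier := Set.range (hρ.stalkEmb x')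
  mul_mem' := by
    rintro _ _ ⟨a, rfl⟩ ⟨b, rfl⟩
    exact ⟨a * b, map_mul _ _ _⟩
  one_mem' := ⟨1, map_one _⟩
  add_mem' := by
    rintro _ _ ⟨a, rfl⟩ ⟨b, rfl⟩
    exact ⟨a + b, map_add _ _ _⟩
  zero_mem' := ⟨0, map_zero _⟩
  algebraMap_mem' r := ⟨(ρ.stalkMap x').hom (C.presheaf.stalkSpecializes
      (specializes_of_apply_eq x hx').1 r), by
    rw [hρ.stalkEmb_stalkMap]
    exact RingHom.congr_fun (algebraMap_comp_stalkSpecializes (C := C) _) r⟩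

omit [IsIntegral C'] in
/-- Membership in `S_{x'}`. [folklore] -/
theorem IsBlowup.mem_fibreSubalgebra_iff {x' : C'} (hx' : ρ x' = x) {z : C.functionField} :
    z ∈ hρ.fibreSubalgebra x x' hx' ↔ ∃ a, hρ.stalkEmb x' a = z := by
  change z ∈ Set.range (hρ.stalkEmb x') ↔ _
  exact Iff.rfl

/-- `𝒪_{C',x'} ≅ S_{x'}`. [folklore] -/
def IsBlowup.stalkEquivFibreSubalgebra (x' : C') (hx' : ρ x' = x) :
    C'.presheaf.stalk x' ≃+* hρ.fibreSubalgebra x x' hx' :=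
  RingEquiv.ofBijective
    ({ toFun := fun a => ⟨hρ.stalkEmb x' a, (hρ.mem_fibreSubalgebra_iff x hx').mpr ⟨a, rfl⟩⟩
       map_one' := Subtype.ext (map_one _)
       map_mul' := fun _ _ => Subtype.ext (map_mul _ _ _)
       map_zero' := Subtype.ext (map_zero _)
       map_add' := fun _ _ => Subtype.ext (map_add _ _ _) } :
      C'.presheaf.stalk x' →+* hρ.fibreSubalgebra x x' hx')
    ⟨fun a b h => hρ.stalkEmb_injective x' (congrArg Subtype.val h),
      fun z => by
        obtain ⟨a, ha⟩ := (hρ.mem_fibreSubalgebra_iff x hx').mp z.2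
        exact ⟨a, Subtype.ext ha⟩⟩

omit [IsIntegral C'] in
/-- `S_{x'}` is a local ring. [folklore] -/
theorem IsBlowup.isLocalRing_fibreSubalgebra (x' : C') (hx' : ρ x' = x) :
    IsLocalRing (hρ.fibreSubalgebra x x' hx') :=
  IsLocalRing.of_surjective' (hρ.stalkEquivFibreSubalgebra x x' hx').toRingHom
    (hρ.stalkEquivFibreSubalgebra x x' hx').surjective

omit [IsIntegral C'] in
/-- `S_{x'}` is Noetherian. [folklore] -/
theorem IsBlowup.isNoetherianRing_fibreSubalgebra [IsLocallyNoetherian C'] (x' : C')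
    (hx' : ρ x' = x) : IsNoetherianRing (hρ.fibreSubalgebra x x' hx') :=
  isNoetherianRing_of_ringEquiv _ (hρ.stalkEquivFibreSubalgebra x x' hx')

omit [IsIntegral C'] in
include hρ in
/-- A non-zero element of `𝔪_x` gives a non-zero non-unit of `𝒪_{C',x'}`: `𝒪_{C',x'}` is not a
field when `𝒪_{C,x}` is not. [folklore] -/
theorem IsBlowup.not_isField_stalk (x' : C') (hx' : ρ x' = x)
    (hR : ¬ IsField (C.presheaf.stalk x)) : ¬ IsField (C'.presheaf.stalk x') := by
  intro hF
  have hm : maximalIdeal (C.presheaf.stalk x) ≠ ⊥ := isField_iff_maximalIdeal_eq.not.mp hR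
  obtain ⟨m, hm1, hm0⟩ := Submodule.exists_mem_ne_zero_of_ne_bot hm
  let sp := C.presheaf.stalkSpecializes (specializes_of_apply_eq x hx').1
  -- `ρ^♯(sp m)` is a non-zero non-unit
  have hne : (ρ.stalkMap x').hom (sp.hom m) ≠ 0 := by
    intro h0
    apply hm0
    have h1 : sp.hom m = 0 := hρ.stalkMap_injective x' (by rw [h0, map_zero])
    have h2 := congrArg (C.presheaf.stalkSpecializes (specializes_of_apply_eq x hx').2).hom h1
    rw [map_zero] at h2
    rw [← h2]
    change m = ((C.presheaf.stalkSpecializes _) ≫ C.presheaf.stalkSpecializes _).hom m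
    rw [TopCat.Presheaf.stalkSpecializes_comp]
    simp
  have hnu : ¬ IsUnit ((ρ.stalkMap x').hom (sp.hom m)) := by
    intro hu
    have hu' : IsUnit (sp.hom m) := (isUnit_map_iff (ρ.stalkMap x').hom _).mp hu
    have hu'' := hu'.map (C.presheaf.stalkSpecializes (specializes_of_apply_eq x hx').2).hom
    have hid : (C.presheaf.stalkSpecializes (specializes_of_apply_eq x hx').2).hom (sp.hom m) = m := by
      change ((C.presheaf.stalkSpecializes _) ≫ C.presheaf.stalkSpecializes _).hom m = m
      rw [TopCat.Presheaf.stalkSpecializes_comp]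
      simp
    rw [hid] at hu''
    exact (IsLocalRing.mem_maximalIdeal _).mp hm1 hu''
  have hbot : maximalIdeal (C'.presheaf.stalk x') = ⊥ :=
    IsLocalRing.isField_iff_maximalIdeal_eq.mp hF
  have hmem : (ρ.stalkMap x').hom (sp.hom m) ∈ maximalIdeal (C'.presheaf.stalk x') :=
    (IsLocalRing.mem_maximalIdeal _).mpr hnu
  rw [hbot, Ideal.mem_bot] at hmem
  exact hne hmem

/-- **`dim S_{x'} = 1`** when `dim 𝒪_{C,x} = 1` (`dim 𝒪_{C',x'} ≤ dim 𝒪_{C,x}`, and `𝒪_{C',x'}`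
is not a field). [cite: Kollar2007, §1.4] -/
theorem IsBlowup.ringKrullDim_fibreSubalgebra (x' : C') (hx' : ρ x' = x)
    (hdim : ringKrullDim (C.presheaf.stalk x) = 1) :
    ringKrullDim (hρ.fibreSubalgebra x x' hx') = 1 := by
  rw [← RingEquiv.ringKrullDim (hρ.stalkEquivFibreSubalgebra x x' hx')]
  have hle : ringKrullDim (C'.presheaf.stalk x') ≤ 1 := by
    have h := hρ.ringKrullDim_stalk_le x'
    rw [hx'] at h
    exact h.trans hdim.le
  have hnf : ¬ IsField (C.presheaf.stalk x) :=
    (ringKrullDim_eq_one_iff_of_isLocalRing_isDomain.mp hdim).1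
  have hnf' := IsBlowup.not_isField_stalk hρ x x' hx' hnf
  have hpos : ¬ ringKrullDim (C'.presheaf.stalk x') ≤ 0 := fun h => by
    haveI : Ring.KrullDimLE 0 (C'.presheaf.stalk x') := Ring.krullDimLE_iff.mpr h
    exact hnf' Ring.KrullDimLE.isField_of_isDomain
  exact le_antisymm hle (Order.succ_le_of_lt (lt_of_not_ge hpos))

/-- Finite normalization transports to `S_{x'}`. [folklore] -/
theorem IsBlowup.module_finite_fibreSubalgebra (x' : C') (hx' : ρ x' = x)
    [Module.Finite (C'.presheaf.stalk x')
      (integralClosure (C'.presheaf.stalk x') C'.functionField)] :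
    Module.Finite (hρ.fibreSubalgebra x x' hx')
      (integralClosure (hρ.fibreSubalgebra x x' hx') C.functionField) :=
  module_finite_integralClosure_of_ringEquiv (hρ.stalkEquivFibreSubalgebra x x' hx')
    C'.functionField C.functionField

omit [IsIntegral C'] in
/-- **`𝔪_x ⊆ c S_{x'}` for some `c ∈ 𝔪_x`** (the generator `c_j` of the chart through `x'`:
`J_x = 𝔪_x` becomes principal on the blowing up). [cite: Kollar2007, §1.4] -/
theorem IsBlowup.exists_generator_fibreSubalgebra (x' : C') (hx' : ρ x' = x)
    (hJx : stalkIdeal J x = maximalIdeal (C.presheaf.stalk x)) :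
    ∃ t ∈ maximalIdeal (C.presheaf.stalk x), ∀ m ∈ maximalIdeal (C.presheaf.stalk x),
      ∃ b ∈ hρ.fibreSubalgebra x x' hx',
        algebraMap (C.presheaf.stalk x) C.functionField m =
          algebraMap (C.presheaf.stalk x) C.functionField t * b := by
  -- the two specializations and the induced isomorphisms of stalks
  obtain ⟨h1, h2⟩ := specializes_of_apply_eq (ρ := ρ) x hx'
  let sp := C.presheaf.stalkSpecializes h1   -- `𝒪_x → 𝒪_{ρ x'}`
  let sp' := C.presheaf.stalkSpecializes h2  -- `𝒪_{ρ x'} → 𝒪_x`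
  have hsp'sp : ∀ r, sp'.hom (sp.hom r) = r := fun r => by
    change (sp ≫ sp').hom r = r
    simp only [sp, sp', TopCat.Presheaf.stalkSpecializes_comp]
    simp
  have hspsp' : ∀ r, sp.hom (sp'.hom r) = r := fun r => by
    change (sp' ≫ sp).hom r = r
    simp only [sp, sp', TopCat.Presheaf.stalkSpecializes_comp]
    simp
  -- `J_{ρ x'} = 𝔪_{ρ x'}`
  have hJx' : stalkIdeal J (ρ x') = maximalIdeal (C.presheaf.stalk (ρ x')) := by
    rw [hx']; exact hJx
  -- chart data at `x'`
  obtain ⟨k, c, hc⟩ := exists_fin_span_eq_stalkIdeal J (ρ x')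
  obtain ⟨j, 𝔴, χ, hχ, hloc, -⟩ := hρ.exists_reesChart_stalk x' c hc
  letI := χ.toAlgebra
  haveI := hloc
  haveI : Nontrivial (chartRing c j) := ⟨⟨0, 1, fun h0 =>
    𝔴.isPrime.ne_top ((Ideal.eq_top_iff_one 𝔴.asIdeal).mpr (h0 ▸ 𝔴.asIdeal.zero_mem))⟩⟩
  have hφcj : chartBase c j (c j) ≠ 0 :=
    nonZeroDivisors.ne_zero (reesChartBase_mem_nonZeroDivisors _ _)
  have hcj : c j ≠ 0 := fun h0 => hφcj ((congrArg (chartBase c j) h0).trans (map_zero _))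
  -- the canonical embedding is the chart embedding
  have hε : locEmb C.functionField c j hcj 𝔴.asIdeal (C'.presheaf.stalk x') = hρ.stalkEmb x' := by
    refine hρ.stalkEmb_unique x' _ (RingHom.ext fun a => ?_)
    rw [RingHom.comp_apply, ← hχ]
    exact locEmb_chartBase C.functionField c j hcj 𝔴.asIdeal _ a
  -- `c_j ∈ 𝔪_{ρ x'}`, `t = sp'(c_j) ∈ 𝔪_x`
  have hcjm : c j ∈ maximalIdeal (C.presheaf.stalk (ρ x')) := by
    rw [← hJx', ← hc]; exact Ideal.subset_span ⟨j, rfl⟩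
  refine ⟨sp'.hom (c j), ?_, fun m hm => ?_⟩
  · by_contra ht
    have hu : IsUnit (sp'.hom (c j)) := not_not.mp ((IsLocalRing.mem_maximalIdeal _).not.mp ht)
    have hu' := hu.map sp.hom
    rw [hspsp'] at hu'
    exact (IsLocalRing.mem_maximalIdeal _).mp hcjm hu'
  · -- `sp m ∈ 𝔪_{ρ x'} = (c)`, so `sp m = c_j b` in the chart
    have hm' : sp.hom m ∈ Ideal.span (Set.range c) := by
      rw [hc, hJx']
      by_contra hnm
      have hu : IsUnit (sp.hom m) := not_not.mp ((IsLocalRing.mem_maximalIdeal _).not.mp hnm)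
      have hu' := hu.map sp'.hom
      rw [hsp'sp] at hu'
      exact (IsLocalRing.mem_maximalIdeal _).mp hm hu'
    obtain ⟨b, hb, hmb⟩ := exists_mem_pointSubalgebra_eq_mul C.functionField c j hcj 𝔴.asIdeal
      (C'.presheaf.stalk x') hm'
    refine ⟨b, ?_, ?_⟩
    · obtain ⟨y, rfl⟩ := (mem_pointSubalgebra_iff C.functionField c j hcj 𝔴.asIdeal _).mp hb
      rw [hε]
      exact (hρ.mem_fibreSubalgebra_iff x hx').mpr ⟨y, rfl⟩
    · have e1 := RingHom.congr_fun (algebraMap_comp_stalkSpecializes (C := C) h1) m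
      have e2 := RingHom.congr_fun (algebraMap_comp_stalkSpecializes (C := C) h2) (c j)
      rw [RingHom.comp_apply] at e1 e2
      change algebraMap _ _ (sp.hom m) = _ at e1
      change algebraMap _ _ (sp'.hom (c j)) = _ at e2
      rw [← e1, hmb, e2]

end Fibre

/-! ## Branches -/

section Branch

variable (hρ : IsBlowup ρ J) (x : C)
  [IsDedekindDomain (integralClosure (C.presheaf.stalk x) C.functionField)]

omit [IsIntegral C'] [IsLocallyNoetherian C] in
/-- `𝒪_{C,x} ⊆ R̄_𝔑` for every maximal ideal `𝔑` of the normalization `R̄`. [folklore] -/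
theorem algebraMap_mem_valuationSubringAtPrime
    (v : HeightOneSpectrum (integralClosure (C.presheaf.stalk x) C.functionField))
    (r : C.presheaf.stalk x) :
    algebraMap (C.presheaf.stalk x) C.functionField r ∈ v.valuationSubringAtPrime C.functionField := by
  haveI : IsFractionRing (integralClosure (C.presheaf.stalk x) C.functionField) C.functionField :=
    isFractionRing_integralClosure _ _
  rw [mem_valuationSubringAtPrime_iff]
  exact HeightOneSpectrum.valuation_le_one v
    (algebraMap (C.presheaf.stalk x) (integralClosure (C.presheaf.stalk x) C.functionField) r)

omit [IsIntegral C'] [IsLocallyNoetherian C] in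
/-- Units of `R̄_𝔑` have valuation `1`. [folklore] -/
theorem valuation_eq_one_of_isUnit
    (v : HeightOneSpectrum (integralClosure (C.presheaf.stalk x) C.functionField))
    {y : v.valuationSubringAtPrime C.functionField} (hy : IsUnit y) :
    haveI : IsFractionRing (integralClosure (C.presheaf.stalk x) C.functionField) C.functionField :=
      isFractionRing_integralClosure _ _
    v.valuation C.functionField (y : C.functionField) = 1 := by
  haveI : IsFractionRing (integralClosure (C.presheaf.stalk x) C.functionField) C.functionField :=
    isFractionRing_integralClosure _ _
  obtain ⟨w, hw⟩ := hy.exists_right_inv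
  have h1 : v.valuation C.functionField (y : C.functionField) ≤ 1 :=
    (mem_valuationSubringAtPrime_iff v _).mp y.2
  have h2 : v.valuation C.functionField (w : C.functionField) ≤ 1 :=
    (mem_valuationSubringAtPrime_iff v _).mp w.2
  have h3 : v.valuation C.functionField (y : C.functionField) *
      v.valuation C.functionField (w : C.functionField) = 1 := by
    rw [← map_mul, ← Subring.coe_mul, show ((y * w : v.valuationSubringAtPrime C.functionField) :
      C.functionField) = 1 from by rw [hw]; rfl, map_one]
  refine le_antisymm h1 ?_
  calc (1 : WithZero (Multiplicative ℤ)) = _ := h3.symm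
    _ ≤ v.valuation C.functionField (y : C.functionField) * 1 := mul_le_mul_right h2 _
    _ = _ := mul_one _

omit [IsIntegral C'] [IsLocallyNoetherian C] in
/-- `𝒪_{C,x} → R̄_𝔑` is local (the maximal ideals of `R̄` lie over `𝔪_x`). [folklore] -/
theorem isLocalHom_toValuationSubring
    [Module.Finite (C.presheaf.stalk x) (integralClosure (C.presheaf.stalk x) C.functionField)]
    (v : HeightOneSpectrum (integralClosure (C.presheaf.stalk x) C.functionField)) :
    IsLocalHom (stalkToValuationSubring x (v.valuationSubringAtPrime C.functionField)
      (algebraMap_mem_valuationSubringAtPrime x v)) := by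
  haveI : IsFractionRing (integralClosure (C.presheaf.stalk x) C.functionField) C.functionField :=
    isFractionRing_integralClosure _ _
  haveI : Algebra.IsIntegral (C.presheaf.stalk x)
      (integralClosure (C.presheaf.stalk x) C.functionField) := Algebra.IsIntegral.of_finite _ _
  refine ⟨fun r hu => ?_⟩
  by_contra hr
  have hrm : r ∈ maximalIdeal (C.presheaf.stalk x) := (IsLocalRing.mem_maximalIdeal _).mpr hr
  -- `r ∈ 𝔑 ∩ R = 𝔪`, so `v(r) < 1`
  haveI : v.asIdeal.IsMaximal := v.isPrime.isMaximal v.ne_bot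
  have hover : v.asIdeal.comap (algebraMap (C.presheaf.stalk x)
      (integralClosure (C.presheaf.stalk x) C.functionField)) = maximalIdeal _ :=
    IsLocalRing.eq_maximalIdeal (Ideal.isMaximal_comap_of_isIntegral_of_isMaximal v.asIdeal)
  have hrv : algebraMap (C.presheaf.stalk x) (integralClosure (C.presheaf.stalk x) C.functionField) r ∈
      v.asIdeal := by
    rw [← Ideal.mem_comap, hover]; exact hrm
  have hlt := (HeightOneSpectrum.valuation_lt_one_iff_mem (K := C.functionField) v _).mpr hrv
  have heq := valuation_eq_one_of_isUnit x v hu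
  change v.valuation C.functionField (algebraMap (C.presheaf.stalk x) C.functionField r) = 1 at heq
  rw [IsScalarTower.algebraMap_apply (C.presheaf.stalk x)
    (integralClosure (C.presheaf.stalk x) C.functionField) C.functionField] at heq
  exact (heq ▸ hlt).false

include hρ in
/-- **Containment is domination**: a ring homomorphism `g : 𝒪_{C',x'} → R̄_𝔑` inducing the
canonical embedding is automatically local when `dim 𝒪_{C',x'} ≤ 1` (otherwise every non-zero
element of `𝒪_{C',x'}` would be a unit of `R̄_𝔑`, forcing `R̄_𝔑 = K(C)`). [cite: Kollar2007, §1.4] -/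
theorem IsBlowup.isLocalHom_of_comp_eq_stalkEmb (x' : C') (hx' : ρ x' = x)
    (hdim : ringKrullDim (C.presheaf.stalk x) = 1)
    (v : HeightOneSpectrum (integralClosure (C.presheaf.stalk x) C.functionField))
    (g : C'.presheaf.stalk x' →+* v.valuationSubringAtPrime C.functionField)
    (hg : (v.valuationSubringAtPrime C.functionField).subtype.comp g = hρ.stalkEmb x') :
    IsLocalHom g := by
  haveI : IsFractionRing (integralClosure (C.presheaf.stalk x) C.functionField) C.functionField :=
    isFractionRing_integralClosure _ _
  -- `𝒪_{C',x'}` has dimension `1`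
  have hdim' : ringKrullDim (C'.presheaf.stalk x') = 1 := by
    rw [RingEquiv.ringKrullDim (hρ.stalkEquivFibreSubalgebra x x' hx')]
    exact hρ.ringKrullDim_fibreSubalgebra x x' hx' hdim
  haveI : Ring.KrullDimLE 1 (C'.presheaf.stalk x') := Ring.krullDimLE_iff.mpr hdim'.le
  refine ⟨fun a hu => ?_⟩
  by_contra ha
  -- the prime `𝔭 = g⁻¹(𝔪_V)` misses `a ∈ 𝔪`, so it is `⊥`
  let 𝔭 : Ideal (C'.presheaf.stalk x') := (maximalIdeal _).comap g
  haveI h𝔭 : 𝔭.IsPrime := Ideal.IsPrime.comap g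
  have ha𝔭 : a ∉ 𝔭 := fun h => ((IsLocalRing.mem_maximalIdeal _).mp h) hu
  have ham : a ∈ maximalIdeal (C'.presheaf.stalk x') := (IsLocalRing.mem_maximalIdeal _).mpr ha
  have h𝔭bot : 𝔭 = ⊥ := by
    by_contra hne
    have hmax : 𝔭.IsMaximal :=
      (Ring.krullDimLE_one_iff_of_noZeroDivisors.mp inferInstance) 𝔭 hne h𝔭
    exact ha𝔭 (IsLocalRing.eq_maximalIdeal hmax ▸ ham)
  -- hence every non-zero element of `𝒪_{C',x'}` is a unit of `V`, and `V = K(C)`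
  have hunits : ∀ b : C'.presheaf.stalk x', b ≠ 0 → IsUnit (g b) := by
    intro b hb0
    by_contra hbu
    have : b ∈ 𝔭 := (IsLocalRing.mem_maximalIdeal _).mpr hbu
    rw [h𝔭bot, Ideal.mem_bot] at this
    exact hb0 this
  apply valuationSubringAtPrime_ne_top (F := C.functionField) v
  refine eq_top_iff.mpr fun z _ => ?_
  -- `z = ε(b₁) / ε(b₂)` with `b₂ ≠ 0`
  haveI : IsFractionRing (hρ.fibreSubalgebra x x' hx') C.functionField := inferInstance
  obtain ⟨s₁, s₂, hs₂, rfl⟩ := IsFractionRing.div_surjective (A := hρ.fibreSubalgebra x x' hx') z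
  obtain ⟨b₁, hb₁⟩ := (hρ.mem_fibreSubalgebra_iff x hx').mp s₁.2
  obtain ⟨b₂, hb₂⟩ := (hρ.mem_fibreSubalgebra_iff x hx').mp s₂.2
  have hb₂0 : b₂ ≠ 0 := by
    intro h0
    apply nonZeroDivisors.ne_zero hs₂
    exact Subtype.ext (by rw [← hb₂, h0, map_zero]; rfl)
  obtain ⟨u, hu⟩ := hunits b₂ hb₂0
  have e₁ : (algebraMap (hρ.fibreSubalgebra x x' hx') C.functionField s₁) = (g b₁ : C.functionField) := by
    change (s₁ : C.functionField) = _
    rw [← hb₁, ← hg]; rfl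
  have e₂ : (algebraMap (hρ.fibreSubalgebra x x' hx') C.functionField s₂) = (g b₂ : C.functionField) := by
    change (s₂ : C.functionField) = _
    rw [← hb₂, ← hg]; rfl
  rw [e₁, e₂, ← hu, div_eq_mul_inv]
  have hinv : (((u⁻¹ : (v.valuationSubringAtPrime C.functionField)ˣ) :
      v.valuationSubringAtPrime C.functionField) : C.functionField) =
        ((u : v.valuationSubringAtPrime C.functionField) : C.functionField)⁻¹ := by
    apply eq_inv_of_mul_eq_one_left
    have h1 : ((u⁻¹ : (v.valuationSubringAtPrime C.functionField)ˣ) :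
        v.valuationSubringAtPrime C.functionField) * u = 1 := u.inv_mul
    have h2 := congrArg (fun w : v.valuationSubringAtPrime C.functionField => (w : C.functionField)) h1
    simp only [MulMemClass.coe_mul, OneMemClass.coe_one] at h2
    exact h2
  rw [← hinv]
  exact (v.valuationSubringAtPrime C.functionField).mul_mem _ _ (g b₁).2 (SetLike.coe_mem _)

end Branch

/-! ## The first neighbourhood and the inequality -/

section Assembly

variable (hρ : IsBlowup ρ J) [IsProper ρ] (x : C) [IsLocallyNoetherian C']
  [Module.Finite (C.presheaf.stalk x) (integralClosure (C.presheaf.stalk x) C.functionField)]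
  (hJx : stalkIdeal J x = maximalIdeal (C.presheaf.stalk x))
  (hdim : ringKrullDim (C.presheaf.stalk x) = 1)
  (hfin : ∀ x' : C', ρ x' = x →
    Module.Finite (C'.presheaf.stalk x') (integralClosure (C'.presheaf.stalk x') C'.functionField))

/-- The normalization of `𝒪_{C,x}` is a Dedekind domain. [folklore] -/
theorem isDedekindDomain_integralClosure_stalk (hdim : ringKrullDim (C.presheaf.stalk x) = 1) :
    IsDedekindDomain (integralClosure (C.presheaf.stalk x) C.functionField) :=
  isDedekindDomain_integralClosure_of_module_finite _ _ hdim.le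

include hJx hdim hfin in
/-- **The local rings of the points over `x` form a first neighbourhood of `𝒪_{C,x}`** inside
`K(C)` (`CurveDeltaDrop.IsFirstNeighbourhood`). [cite: Kollar2007, §1.4] -/
theorem IsBlowup.isFirstNeighbourhood_fibreSubalgebra :
    haveI := isDedekindDomain_integralClosure_stalk x hdim
    IsFirstNeighbourhood (fun i : {x' : C' // ρ x' = x} => hρ.fibreSubalgebra x i.1 i.2) := by
  haveI := isDedekindDomain_integralClosure_stalk x hdim
  haveI : IsFractionRing (integralClosure (C.presheaf.stalk x) C.functionField) C.functionField :=
    isFractionRing_integralClosure _ _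
  refine
    { isLocalRing := fun i => hρ.isLocalRing_fibreSubalgebra x i.1 i.2
      isNoetherianRing := fun i => hρ.isNoetherianRing_fibreSubalgebra x i.1 i.2
      ringKrullDim_eq_one := fun i => hρ.ringKrullDim_fibreSubalgebra x i.1 i.2 hdim
      module_finite := fun i => by
        haveI := hfin i.1 i.2
        exact hρ.module_finite_fibreSubalgebra x i.1 i.2
      exists_generator := fun i => hρ.exists_generator_fibreSubalgebra x i.1 i.2 hJx
      existsUnique_branch := fun v => ?_ }
  let V := v.valuationSubringAtPrime C.functionField
  have hV := algebraMap_mem_valuationSubringAtPrime x v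
  have hloc := isLocalHom_toValuationSubring x v
  have hmemV : ∀ z : C.functionField, z ∈ V ↔ v.valuation C.functionField z ≤ 1 :=
    fun z => mem_valuationSubringAtPrime_iff v z
  refine ⟨?_, ?_, ?_⟩
  · -- existence: the valuative criterion of properness
    exact ⟨(hρ.exists_point_stalkEmb_mem x V hV hloc).choose,
      (hρ.exists_point_stalkEmb_mem x V hV hloc).choose_spec.1⟩
  · obtain ⟨hx', g, -, hg⟩ := (hρ.exists_point_stalkEmb_mem x V hV hloc).choose_spec
    intro z hz
    obtain ⟨a, rfl⟩ := (hρ.mem_fibreSubalgebra_iff x _).mp hz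
    rw [← hmemV, show hρ.stalkEmb _ a = (g a : C.functionField) from (RingHom.congr_fun hg a).symm]
    exact (g a).2
  · -- uniqueness: the valuative criterion of separatedness
    rintro ⟨x'', hx''⟩ h''
    set x₀ := (hρ.exists_point_stalkEmb_mem x V hV hloc).choose with hx₀
    obtain ⟨hx₀', g₀, hg₀loc, hg₀⟩ := (hρ.exists_point_stalkEmb_mem x V hV hloc).choose_spec
    -- the embedding of `𝒪_{C',x''}` lands in `V`
    have hmem : ∀ a, hρ.stalkEmb x'' a ∈ V := fun a =>
      (hmemV _).mpr (h'' _ ((hρ.mem_fibreSubalgebra_iff x hx'').mpr ⟨a, rfl⟩))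
    let g'' : C'.presheaf.stalk x'' →+* V := (hρ.stalkEmb x'').codRestrict V.toSubring hmem
    have hg'' : V.subtype.comp g'' = hρ.stalkEmb x'' := RingHom.ext fun _ => rfl
    haveI := hρ.isLocalHom_of_comp_eq_stalkEmb x x'' hx'' hdim v g'' hg''
    haveI := hg₀loc
    exact Subtype.ext (hρ.eq_of_stalkEmb_factors x V hV hloc hx'' hx₀' g'' hg'' g₀ hg₀)

include hρ hJx hdim hfin in
/-- **The points of the blowing up over `x` are finite in number** (branches through distinct
points are distinct, and `𝒪_{C,x}` has finitely many branches). [cite: Kollar2007, §1.4] -/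
theorem IsBlowup.finite_fibre : Finite {x' : C' // ρ x' = x} := by
  haveI := isDedekindDomain_integralClosure_stalk x hdim
  haveI : IsFractionRing (integralClosure (C.presheaf.stalk x) C.functionField) C.functionField :=
    isFractionRing_integralClosure _ _
  have hS := hρ.isFirstNeighbourhood_fibreSubalgebra x hJx hdim hfin
  haveI : Finite (HeightOneSpectrum (integralClosure (C.presheaf.stalk x) C.functionField)) :=
    finite_heightOneSpectrum _ _
  refine Finite.of_injective (fun i => (hS.exists_branch i).choose) fun i i' h => ?_
  have h1 := (hS.exists_branch i).choose_spec
  have h2 := (hS.exists_branch i').choose_spec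
  change (hS.exists_branch i).choose = (hS.exists_branch i').choose at h
  rw [h] at h1
  exact hS.branch_unique h1 h2

include hρ hJx hdim hfin in
/-- **`Σ_{ρ x' = x} δ(𝒪_{C',x'}) < δ(𝒪_{C,x})` for a singular point `x`** of a curve under the
blowing up of `x` (Kollár 2007, §1.4; the termination input of steps 1–2 of the algorithm of
Cossart–Piltant 2008, Prop. 4.4). [cite: Kollar2007, §1.4]
[cite: CossartPiltant2008, proof of Prop. 4.4, p. 10] -/
theorem IsBlowup.sum_curveDelta_fibre_lt (hsing : ¬ IsDiscreteValuationRing (C.presheaf.stalk x)) :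
    ∑ᶠ i : {x' : C' // ρ x' = x}, curveDelta (C'.presheaf.stalk i.1) C'.functionField <
      curveDelta (C.presheaf.stalk x) C.functionField := by
  classical
  haveI := isDedekindDomain_integralClosure_stalk x hdim
  haveI : IsFractionRing (integralClosure (C.presheaf.stalk x) C.functionField) C.functionField :=
    isFractionRing_integralClosure _ _
  haveI : Finite {x' : C' // ρ x' = x} := hρ.finite_fibre x hJx hdim hfin
  haveI : Fintype {x' : C' // ρ x' = x} := Fintype.ofFinite _
  have hS := hρ.isFirstNeighbourhood_fibreSubalgebra x hJx hdim hfin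
  have hlt := hS.sum_curveDelta_lt hdim hsing
  rw [finsum_eq_sum_of_fintype]
  convert hlt using 2 with i
  exact curveDelta_eq_of_ringEquiv (hρ.stalkEquivFibreSubalgebra x i.1 i.2) _ _

end Assembly



end Literature.AlgebraicGeometry.Resolution

end
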